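import Mathlib
import HarnessLib
import Summits.NavierStokesRegularity.NavierStokesRegularity.Theses.PoloidalWindowDoor
import Summits.NavierStokesRegularity.NavierStokesRegularity.Theorems.PoloidalWindowDoorPoloidalWindowRigiditySharper
import Summits.NavierStokesRegularity.NavierStokesRegularity.Theorems.PoloidalWindowDoorPoloidalWindowRigidityK2OfLrcSpatial
import Summits.NavierStokesRegularity.NavierStokesRegularity.Theorems.PoloidalWindowDoorPoloidalWindowRigidityHorizontalFlatPast
import Summits.NavierStokesRegularity.NavierStokesRegularity.Theorems.PoloidalWindowDoorPoloidalWindowRigidityEntireGerm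
import Summits.NavierStokesRegularity.NavierStokesRegularity.Theorems.PoloidalWindowDoorPoloidalWindowRigidityTimeShearLiminf
import Summits.NavierStokesRegularity.NavierStokesRegularity.Theorems.PoloidalWindowDoorPoloidalWindowRigidityK2OfLrcSlope
import Summits.NavierStokesRegularity.NavierStokesRegularity.Theorems.PoloidalWindowDoorPoloidalWindowRigidityStubUntwisted
import Summits.NavierStokesRegularity.NavierStokesRegularity.Theorems.PoloidalWindowDoorPoloidalWindowRigidityWindow
import Summits.NavierStokesRegularity.NavierStokesRegularity.Theorems.PoloidalWindowDoorLrcModEntireTwistingTHLocal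
import Summits.NavierStokesRegularity.NavierStokesRegularity.Theorems.PoloidalWindowDoorLrcModEntireIff
import Summits.NavierStokesRegularity.NavierStokesRegularity.Theorems.AdaptedFrequencyTangentFlowTransferAncientPressure
import Literature.Analysis.FluidPDE.ClassicalSolutionRegion

/-!
# Crux `PoloidalWindowRigidity` (K2, stmt-NavierStokesRegularity-19708) — line `local_rigidity` (skeleton v1)
# «LOCALISATION TRANSFER»: the twisting residue `stub_twisting` from TWO CLASS-FREE LOCAL statements

CRUX-STRATEGIST seat `cstrat-stmt-NavierStokesRegularity-19708` g1 (director-ns g9 req30 (1)), alongside the registered lines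
`Lines/lrc_jet.lean` v5 (lead K2-p1: one sorry `stub_twisting`, `stub_untwisted` PROVED p561151), `Lines/mixed_type.lean` v1
(strategist g0: cut by the TYPE of the kinematic equation, three class-currency stubs) and, on the sibling item 20428,
`Cruxes/LrcModEntire/Lines/twist_split.lean` v3 (cut (TH) / THICK, class + germ currency).

## The cut: LOCAL-ALGEBRAIC versus GLOBAL (the Type-I class leaves the stubs)
Every registered stub of the twisting residue keeps the ROUTE'S CLASS (Type-I time decay, Oseen-mild on `(−∞,0)`, backward
singular apex) among its hypotheses, while every engine of the cell that has produced verdicts (nsreg-p7 g10/g11 `jetslp`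
eliminations, ns-poloidal-K2-cert-1 censuses / `FarJet8` / `CslJetBase`, ns-poloidal-K2-p2 (TH) laws, refuter1 K-47/K-48) computes a
LOCAL problem: the compatibility of the poloidal Navier–Stokes system with a twisting jet AT ONE SPACE–TIME POINT, to all orders.
This line registers exactly the two local statements those engines decide, and proves — from LANDED tree theorems only — that
together they close `stub_twisting` verbatim (hence the crux, along the `lrc_jet` v5 chain):

* `stub_localTHEmpty` — **the local (TH) ∩ twisting system is EMPTY**: VERBATIM the hypothesis `hempty` of the tree theorem
  `…Theorems.PoloidalWindowDoorLrcModEntireTwistingTHLocal.stub_twistingTH_of_localEmpty` (ns-poloidal-K2-p3 g7, landed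
  `--supports` 20428): no real-analytic `u` on an open space–time set with analytic slope `μ(t,z)` and pressure datum `A(t,z)`
  satisfies the four (TH) laws (poloidal, div-free, proportional shear `∂₂u_b = μ(t,y₂)∂_b u₂`, nsreg-p7's vertical momentum
  equation `E`) with, at one point, twist `≠ 0`, `μ ∉ {0,1}`, `∂_z μ ≠ 0`.  ONE certificate (exact elimination or human) closes this
  stub, `twist_split::stub_twistingTH` (20428) and the (TH) parts of `mixed_type` simultaneously — it is stated ONCE, in the currency
  the certificates are written in.  No class, no apex, no time sign.
* `stub_localThickTH` — **a twisting germ is somewhere time–height** (the THICK residue, LOCALISED; new): every jointly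
  real-analytic classical Navier–Stokes germ `(u, q)` on an open space–time set `U` (`IsClassicalNSSolutionOnRegion U 1 0 u q` —
  the momentum equation WITH ITS PRESSURE is kept, see «Disproof used» in the card), poloidal along `e₃`, non-degenerate and twisting
  at every point of `U`, admits a nonempty open `U₁ ⊆ U` on which the shear slope is a function of `(t, x₂)`.  Equivalently: there is
  NO THICK twisting poloidal NS germ — not even a local one, let alone a bounded ancient one (refuter1 K-48: no witness of any kind is
  known; cert-1 CERT-MEMO-3: the general steady scheme is over-determined from jet order 13 (excess 7), the unsteady one from order 16
  modulo gauge; cdisprove §S: the velocity-symmetric thick steady germs are numerically EMPTY).  No class, no apex, no time sign.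

## Composition (kernel-checked, no `sorry` outside the two stubs)
`twisting_of_localRigidity` = `lrc_jet::stub_twisting` VERBATIM: a class profile is classical on `(−∞,0) × ℝ³` for one smooth
pressure (`…AdaptedFrequencyTangentFlowTransferAncientPressure.exists_isClassicalNSSolutionOn_Iio_of_isTypeIAncientMild` ∘
`…Window.isTypeIAncientMild_of_class`), hence on the window `W` (`IsClassicalNSSolutionOn.onRegion`, `.mono_of_isOpen`); it is
jointly real-analytic there (`…Ancient.analyticOnNhd_uncurry`); `stub_localThickTH` yields a (TH) sub-window `U₁ ⊆ W`, which inherits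
non-degeneracy, the (TV)-pin and the twist; `stub_twistingTH_of_localEmpty stub_localTHEmpty` turns it into a symmetry/entire germ
and `…LrcModEntireIff.eq_zero_of_germ` into `v ≡ 0`, which is not backward-singular (`…Flat.not_backwardSingular_of_zero`).  Then the
`lrc_jet` v5 chain verbatim: `ndRegular` (twist dichotomy over the landed `stub_untwisted`), `lrcSpatial_of_stubs`, `tv_of_stubs`,
`sliceSharpNonflatLiouville_of_localRigidity`, `PoloidalWindowRigidity_of_localRigidity : …Theses.PoloidalWindowDoor.PoloidalWindowRigidity`.

## Why this dodges the STUCK goal of the current line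
The lead's stuck goal is `stub_twisting` whole: «non-degenerate twisting poloidal CLASS profile with the (TV)-pin ⇒ regular», for
which no Liouville mechanism is known (TWISTING-NOTE v2; Lei–Ren arXiv:2501.08976 Rem 1.3: the non-axisymmetric `ω₃ ≡ 0` class is
open in print) and which cannot be refuted without CONSTRUCTING a Type-I ancient twisting solution.  The two local stubs need
neither: they are decidable branch-by-branch targets of differential elimination (Riquier–Janet / Thomas decomposition of the
poloidal NS system in the twisting ranking — the named tool the cell's engines implement), an INCONSISTENT verdict is a finite
polynomial certificate in jet variables (tree patterns `…LrcJetKernel*`, `…FarJet8`, `…CslJetBase`), and either stub is KILLED by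
ONE explicit local germ (no globalisation into the class required) — so both outcomes of the running computations land here
directly, with no Type-I bookkeeping left for any prover.  HONEST RISK: the local statements are logically STRONGER than the
class residues — a twisting non-(TV) germ that never globalises would refute a stub while `stub_twisting` survives; then the line
dies informatively (the germ is the K-a‴ object the whole cell is hunting) and the class-currency lines remain.

WHAT THIS IS NOT: not a proof of K2, of `stub_twisting`, or of anything about Navier–Stokes regularity (Clay (A) is untouched) —
a registered re-statement of the twisting residue as two local emptiness problems, with the transfer to the crux kernel-checked.
-/

-- the summit and its single sub-problem share the name (CONVENTIONS §1)
set_option linter.dupNamespace false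

namespace Summit.NavierStokesRegularity.NavierStokesRegularity.Cruxes.PoloidalWindowRigidity.LocalRigidity

open Set Function Metric InnerProductSpace
open scoped RealInnerProductSpace InnerProductSpace Topology Laplacian ContDiff
open Literature.Analysis Literature.Analysis.FluidPDE
open Summit.NavierStokesRegularity.NavierStokesRegularity.Theorems
open Summit.NavierStokesRegularity.NavierStokesRegularity.Theorems.PoloidalWindowDoorPoloidalWindowRigiditySharper
open Summit.NavierStokesRegularity.NavierStokesRegularity.Theorems.PoloidalWindowDoorPoloidalWindowRigidityK2OfLrcSpatial
open Summit.NavierStokesRegularity.NavierStokesRegularity.Theorems.PoloidalWindowDoorPoloidalWindowRigidityHorizontalFlatPast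
open Summit.NavierStokesRegularity.NavierStokesRegularity.Theorems.PoloidalWindowDoorPoloidalWindowRigidityK2OfLrcSlope
open Summit.NavierStokesRegularity.NavierStokesRegularity.Theorems.TubeAlternative.AnalyticPropagation
open Summit.NavierStokesRegularity.NavierStokesRegularity.Theorems.LocalSineTubeDoorProfileAlignedWindowRigidityAncient
open Summit.NavierStokesRegularity.NavierStokesRegularity.Theorems.PoloidalWindowDoorPoloidalWindowRigidityWindow
open Summit.NavierStokesRegularity.NavierStokesRegularity.Theorems.PoloidalWindowDoorLrcModEntireTwistingTHLocal
open Summit.NavierStokesRegularity.NavierStokesRegularity.Theorems.PoloidalWindowDoorLrcModEntireIff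
open Summit.NavierStokesRegularity.NavierStokesRegularity.Theorems.PoloidalWindowDoorPoloidalWindowRigidityFlat

/-! ### The two registered stubs (class-free, local) -/

/-- **STUB (L-TH): THE LOCAL (TH) ∩ TWISTING SYSTEM IS EMPTY** — verbatim the hypothesis `hempty` of the tree theorem
`…PoloidalWindowDoorLrcModEntireTwistingTHLocal.stub_twistingTH_of_localEmpty`.  No real-analytic velocity field `u(t,y)` on an
open space–time set `U ∋ p₀`, with real-analytic slope `μ(t,z)` and pressure datum `A(t,z)` of `(time, height)`, satisfies on `U`
poloidality `∂₀u₁ = ∂₁u₀`, incompressibility, the proportional-shear law `∂₂u_b = μ(t,y₂) ∂_b u₂` (`b = 0,1`) and the vertical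
momentum equation with the (TH) pressure law `(1−μ)(∂ₜu₂ + u·∇u₂ − Δu₂) = A + (μ_t − μ_zz)u₂ + (μ_z/2)u₂² − 2μ_z∂₂u₂`
(nsreg-p7 STRUCTURE-g11 `E`), together with, AT `p₀`, twist `{∂₂u₂,u₂}ₕ ≠ 0`, `μ ≠ 0`, `μ ≠ 1`, `∂_z μ ≠ 0`.
Lanes: nsreg-p7 (`jetslp` exact elimination, branches `P16`/`Q18`), cert-1 g3, K2-p2 g6 (TH) laws; shared verbatim with
`twist_split::stub_twistingTH` (20428) through the tree reduction.  The dynamics (`E`) is load-bearing: refuter1 K-47's twisted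
column `twistProfile` solves the three kinematic laws with `∂_z μ ≠ 0` (`…LrcModEntire/Negative/TwistedColumn*`). -/
theorem stub_localTHEmpty :
    ∀ (u : ℝ → EuclideanSpace ℝ (Fin 3) → EuclideanSpace ℝ (Fin 3)) (μ A : ℝ → ℝ → ℝ)
      (U : Set (ℝ × EuclideanSpace ℝ (Fin 3))) (p₀ : ℝ × EuclideanSpace ℝ (Fin 3)),
      IsOpen U → p₀ ∈ U →
      AnalyticOnNhd ℝ (Function.uncurry u) U →
      (∀ p ∈ U, AnalyticAt ℝ (Function.uncurry μ) (p.1, p.2 2)) →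
      (∀ p ∈ U, AnalyticAt ℝ (Function.uncurry A) (p.1, p.2 2)) →
      (∀ p ∈ U, fderiv ℝ (u p.1) p.2 (EuclideanSpace.single 0 1) 1 = fderiv ℝ (u p.1) p.2 (EuclideanSpace.single 1 1) 0) →
      (∀ p ∈ U, fderiv ℝ (u p.1) p.2 (EuclideanSpace.single 0 1) 0 + fderiv ℝ (u p.1) p.2 (EuclideanSpace.single 1 1) 1 +
        fderiv ℝ (u p.1) p.2 (EuclideanSpace.single 2 1) 2 = 0) →
      (∀ p ∈ U, ∀ b : Fin 3, b ≠ 2 →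
        fderiv ℝ (u p.1) p.2 (EuclideanSpace.single 2 1) b =
          μ p.1 (p.2 2) * fderiv ℝ (u p.1) p.2 (EuclideanSpace.single b 1) 2) →
      (∀ p ∈ U,
        (1 - μ p.1 (p.2 2)) *
            (deriv (fun s => u s p.2 2) p.1 + fderiv ℝ (fun y => u p.1 y 2) p.2 (u p.1 p.2)
              - Δ (fun y => u p.1 y 2) p.2) =
          A p.1 (p.2 2) + (deriv (fun s => μ s (p.2 2)) p.1 - deriv (deriv (μ p.1)) (p.2 2)) * u p.1 p.2 2
            + deriv (μ p.1) (p.2 2) / 2 * u p.1 p.2 2 ^ 2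
            - 2 * deriv (μ p.1) (p.2 2) * fderiv ℝ (u p.1) p.2 (EuclideanSpace.single 2 1) 2) →
      fderiv ℝ (fun y => fderiv ℝ (u p₀.1) y (EuclideanSpace.single 2 1) 2) p₀.2 (EuclideanSpace.single 0 1) *
            fderiv ℝ (u p₀.1) p₀.2 (EuclideanSpace.single 1 1) 2 -
          fderiv ℝ (fun y => fderiv ℝ (u p₀.1) y (EuclideanSpace.single 2 1) 2) p₀.2 (EuclideanSpace.single 1 1) *
            fderiv ℝ (u p₀.1) p₀.2 (EuclideanSpace.single 0 1) 2 ≠ 0 →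
      μ p₀.1 (p₀.2 2) ≠ 0 → μ p₀.1 (p₀.2 2) ≠ 1 → deriv (μ p₀.1) (p₀.2 2) ≠ 0 → False := by
  sorry

/-- **STUB (L-THICK): A TWISTING POLOIDAL NAVIER–STOKES GERM IS SOMEWHERE TIME–HEIGHT** (the thick residue, localised).
For every classical Navier–Stokes pair `(u, q)` on an open space–time set `U` (unit viscosity, zero force: smooth, momentum
equation with pressure `q`, divergence-free — `IsClassicalNSSolutionOnRegion U 1 0 u q`) with `u` jointly real-analytic on `U`,
poloidal along `e₃` on `U` (`⟪curl u, e₃⟫ = 0`), non-degenerate (`curl u ≠ 0`, `∇ₕu₂ ≠ 0`, `∂₂uₕ ≠ 0`) and TWISTING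
(`∂₀(∂₂u₂)·∂₁u₂ − ∂₁(∂₂u₂)·∂₀u₂ ≠ 0`) at every point of `U`: on some nonempty open `U₁ ⊆ U` the shear slope is a function of
time and height, `∂₂u_b = m(t, y₂) ∂_b u₂` (`b = 0,1`).  (On a non-degenerate poloidal NS germ the horizontal momentum equation
alone gives a common analytic slope `Λ` with `∂₂u_b = Λ ∂_b u₂`; the statement says `Λ` factors through `(t, y₂)` on some open
subset — i.e. there is NO THICK twisting germ.)  Evidence: refuter1 K-48 (no thick witness of any kind, even kinematic-bounded);
cert-1 CERT-MEMO-3 (general steady scheme over-determined from order 13, unsteady from 16 mod gauge; CSL infinitesimally rigid);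
cdisprove §S (`noThickObliqueTwistingGerm`: velocity-symmetric thick steady germs numerically empty, j289657/j289848).  The momentum
equation is load-bearing (kinematic thick germs exist locally by Cauchy–Kovalevskaya for `u_zz + Δₕ[G(u,z)] = 0`, K-48). -/
theorem stub_localThickTH :
    ∀ (u : ℝ → EuclideanSpace ℝ (Fin 3) → EuclideanSpace ℝ (Fin 3)) (q : ℝ → EuclideanSpace ℝ (Fin 3) → ℝ)
      (U : Set (ℝ × EuclideanSpace ℝ (Fin 3))),
      IsOpen U → U.Nonempty →
      Literature.Analysis.FluidPDE.IsClassicalNSSolutionOnRegion U 1 0 u q →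
      AnalyticOnNhd ℝ (Function.uncurry u) U →
      (∀ p ∈ U, ⟪Literature.Analysis.FluidPDE.curl (u p.1) p.2, EuclideanSpace.single 2 1⟫_ℝ = 0) →
      (∀ p ∈ U, Literature.Analysis.FluidPDE.curl (u p.1) p.2 ≠ 0 ∧
        (fderiv ℝ (u p.1) p.2 (EuclideanSpace.single 0 1) 2 ≠ 0 ∨ fderiv ℝ (u p.1) p.2 (EuclideanSpace.single 1 1) 2 ≠ 0) ∧
        (fderiv ℝ (u p.1) p.2 (EuclideanSpace.single 2 1) 0 ≠ 0 ∨ fderiv ℝ (u p.1) p.2 (EuclideanSpace.single 2 1) 1 ≠ 0)) →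
      (∀ p ∈ U,
        fderiv ℝ (fun y => fderiv ℝ (u p.1) y (EuclideanSpace.single 2 1) 2) p.2 (EuclideanSpace.single 0 1) *
            fderiv ℝ (u p.1) p.2 (EuclideanSpace.single 1 1) 2 -
          fderiv ℝ (fun y => fderiv ℝ (u p.1) y (EuclideanSpace.single 2 1) 2) p.2 (EuclideanSpace.single 1 1) *
            fderiv ℝ (u p.1) p.2 (EuclideanSpace.single 0 1) 2 ≠ 0) →
      ∃ U₁ : Set (ℝ × EuclideanSpace ℝ (Fin 3)), U₁ ⊆ U ∧ IsOpen U₁ ∧ U₁.Nonempty ∧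
        ∃ m : ℝ → ℝ → ℝ, ∀ p ∈ U₁, ∀ b : Fin 3, b ≠ 2 →
          fderiv ℝ (u p.1) p.2 (EuclideanSpace.single 2 1) b =
            m p.1 (p.2 2) * fderiv ℝ (u p.1) p.2 (EuclideanSpace.single b 1) 2 := by
  sorry

/-! ### Toolkit (joint continuity of the twist bracket on the slab; as in `mixed_type`) -/

section Toolkit

variable {C : ℝ} {v : ℝ → EuclideanSpace ℝ (Fin 3) → EuclideanSpace ℝ (Fin 3)}

/-- The horizontal derivatives `(s,y) ↦ ∂_b(∂₂v₂)(s,y)` are jointly real-analytic on the slab. -/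
theorem entry2_analyticOnNhd_uncurry (hrate : HasTypeITimeDecay C v)
    (hcont : ContinuousOn (uncurry v) (Iio (0 : ℝ) ×ˢ univ))
    (hmild : ∀ s t : ℝ, s < t → t < 0 → ∀ x,
      v t x = UnboundedOperators.heatExtension (v s) (t - s) x - oseenDuhamel 1 s v v t x) (b : Fin 3) :
    AnalyticOnNhd ℝ (uncurry fun s y =>
      fderiv ℝ (fun x => fderiv ℝ (v s) x (EuclideanSpace.single 2 1) 2) y (EuclideanSpace.single b 1))
      (Iio (0 : ℝ) ×ˢ univ) := by
  have h22 := analyticOnNhd_uncurry_fderiv_entry hrate hcont hmild 2 2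
  exact analyticOnNhd_uncurry_fderiv_slice_apply
    (w := fun s y => fderiv ℝ (v s) y (EuclideanSpace.single 2 1) 2) h22 isOpen_Iio
    (v := fun _ _ => EuclideanSpace.single b 1) analyticOnNhd_const

/-- The twist bracket is jointly continuous on the slab. -/
theorem continuousOn_twist (hrate : HasTypeITimeDecay C v)
    (hcont : ContinuousOn (uncurry v) (Iio (0 : ℝ) ×ˢ univ))
    (hmild : ∀ s t : ℝ, s < t → t < 0 → ∀ x,
      v t x = UnboundedOperators.heatExtension (v s) (t - s) x - oseenDuhamel 1 s v v t x) :
    ContinuousOn (fun z : ℝ × EuclideanSpace ℝ (Fin 3) =>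
      fderiv ℝ (fun x => fderiv ℝ (v z.1) x (EuclideanSpace.single 2 1) 2) z.2 (EuclideanSpace.single 0 1) *
          fderiv ℝ (v z.1) z.2 (EuclideanSpace.single 1 1) 2 -
        fderiv ℝ (fun x => fderiv ℝ (v z.1) x (EuclideanSpace.single 2 1) 2) z.2 (EuclideanSpace.single 1 1) *
          fderiv ℝ (v z.1) z.2 (EuclideanSpace.single 0 1) 2) (Iio (0 : ℝ) ×ˢ univ) := by
  have hD : ∀ j i : Fin 3, ContinuousOn
      (fun z : ℝ × EuclideanSpace ℝ (Fin 3) => fderiv ℝ (v z.1) z.2 (EuclideanSpace.single j 1) i)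
      (Iio (0 : ℝ) ×ˢ univ) := fun j i => continuousOn_fderiv_entry hrate hcont hmild j i
  have hD2 : ∀ b : Fin 3, ContinuousOn
      (fun z : ℝ × EuclideanSpace ℝ (Fin 3) =>
        fderiv ℝ (fun x => fderiv ℝ (v z.1) x (EuclideanSpace.single 2 1) 2) z.2 (EuclideanSpace.single b 1))
      (Iio (0 : ℝ) ×ˢ univ) := fun b => (entry2_analyticOnNhd_uncurry hrate hcont hmild b).continuousOn
  exact ((hD2 0).mul (hD 1 2)).sub ((hD2 1).mul (hD 0 2))

end Toolkit

/-! ### Composition, step 1: `stub_twisting` from the two local stubs (proved) -/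

/-- **NON-DEGENERATE + PIN + TWISTING window ⇒ regular** — VERBATIM the statement of `stub_twisting` of the picked skeleton
`Lines/lrc_jet.lean` v5, PROVED from the two local stubs: the class profile is a jointly real-analytic classical solution on the
window (tree), `stub_localThickTH` gives a (TH) sub-window, which inherits non-degeneracy, the (TV)-pin and the twist, and the tree
reduction `stub_twistingTH_of_localEmpty` fed with `stub_localTHEmpty` turns it into a symmetry/entire germ, fatal for a class
profile (`eq_zero_of_germ`). -/
theorem twisting_of_localRigidity :
    ∀ (C : ℝ) (v : ℝ → EuclideanSpace ℝ (Fin 3) → EuclideanSpace ℝ (Fin 3)),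
      Literature.Analysis.FluidPDE.HasTypeITimeDecay C v →
      ContinuousOn (Function.uncurry v) (Set.Iio (0 : ℝ) ×ˢ Set.univ) →
      (∀ s t : ℝ, s < t → t < 0 → ∀ x, v t x =
        Literature.Analysis.UnboundedOperators.heatExtension (v s) (t - s) x -
          Literature.Analysis.FluidPDE.oseenDuhamel 1 s v v t x) →
      (∀ t < 0, Literature.Analysis.FluidPDE.VectorCalculus.IsDivFree (v t)) →
      (∀ s < 0, ∀ y, ⟪Literature.Analysis.FluidPDE.curl (v s) y, EuclideanSpace.single 2 1⟫_ℝ = 0) →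
      ∀ W : Set (ℝ × EuclideanSpace ℝ (Fin 3)), IsOpen W → W.Nonempty → W ⊆ Set.Iio (0 : ℝ) ×ˢ Set.univ →
        (∀ z ∈ W, Literature.Analysis.FluidPDE.curl (v z.1) z.2 ≠ 0 ∧
          (fderiv ℝ (v z.1) z.2 (EuclideanSpace.single 0 1) 2 ≠ 0 ∨ fderiv ℝ (v z.1) z.2 (EuclideanSpace.single 1 1) 2 ≠ 0) ∧
          (fderiv ℝ (v z.1) z.2 (EuclideanSpace.single 2 1) 0 ≠ 0 ∨ fderiv ℝ (v z.1) z.2 (EuclideanSpace.single 2 1) 1 ≠ 0)) →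
        (∀ m : ℝ → ℝ, ∀ W₁ : Set (ℝ × EuclideanSpace ℝ (Fin 3)), W₁ ⊆ W → IsOpen W₁ → W₁.Nonempty →
          ∃ z ∈ W₁, ∃ b : Fin 3, b ≠ 2 ∧
            fderiv ℝ (v z.1) z.2 (EuclideanSpace.single 2 1) b ≠
              m z.1 * fderiv ℝ (v z.1) z.2 (EuclideanSpace.single b 1) 2) →
        (∀ z ∈ W,
          fderiv ℝ (fun x => fderiv ℝ (v z.1) x (EuclideanSpace.single 2 1) 2) z.2 (EuclideanSpace.single 0 1) *
              fderiv ℝ (v z.1) z.2 (EuclideanSpace.single 1 1) 2 -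
            fderiv ℝ (fun x => fderiv ℝ (v z.1) x (EuclideanSpace.single 2 1) 2) z.2 (EuclideanSpace.single 1 1) *
              fderiv ℝ (v z.1) z.2 (EuclideanSpace.single 0 1) 2 ≠ 0) →
        ¬ Literature.Analysis.FluidPDE.IsBackwardSingularPoint v 0 := by
  intro C v hrate hcont hmild hdiv hpol W hW hWne hWs hnd hpin htw
  -- ## the class profile is a classical solution on the slab, hence on the window, and jointly analytic there
  obtain ⟨q, hq⟩ := exists_isClassicalNSSolutionOn_Iio_of_isTypeIAncientMild (isTypeIAncientMild_of_class hrate hcont hmild hdiv)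
  have hreg : IsClassicalNSSolutionOnRegion W 1 0 v q := hq.onRegion.mono_of_isOpen hWs hW
  have han : AnalyticOnNhd ℝ (uncurry v) W := fun z hz =>
    (analyticOnNhd_uncurry hcont (bdd_of_hasTypeITimeDecay hrate) hmild) z (hWs hz)
  have hpolW : ∀ z ∈ W, ⟪curl (v z.1) z.2, EuclideanSpace.single 2 1⟫_ℝ = 0 := fun z hz =>
    hpol z.1 (Set.mem_prod.1 (hWs hz)).1 z.2
  -- ## the thick stub: a (TH) sub-window
  obtain ⟨U₁, hU₁W, hU₁o, hU₁ne, m, hm⟩ := stub_localThickTH v q W hW hWne hreg han hpolW hnd htw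
  -- ## the (TH) stub through the tree reduction: a germ, fatal in the class
  obtain ⟨s, hs, U, hU, hUne, hgerm⟩ :=
    stub_twistingTH_of_localEmpty stub_localTHEmpty C v hrate hcont hmild hdiv hpol U₁ hU₁o hU₁ne (hU₁W.trans hWs)
      (fun z hz => hnd z (hU₁W hz)) (fun n W₁ hW₁ hW₁o hW₁ne => hpin n W₁ (hW₁.trans hU₁W) hW₁o hW₁ne)
      (fun z hz => htw z (hU₁W hz)) ⟨m, hm⟩
  exact not_backwardSingular_of_zero (eq_zero_of_germ hrate hcont hmild hdiv hpol hs hU hUne hgerm)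

/-! ### Composition, step 3: the crux (exactly as in `lrc_jet` v5, with `twisting_of_localRigidity` for `stub_twisting`) -/

/-- **NON-DEGENERATE + PIN ⇒ regular** — the pointwise twist dichotomy over the tree theorem `…StubUntwisted.stub_untwisted`
(p561151, the untwisted half) and `twisting_of_localRigidity` (the twisting half, from the three stubs). -/
theorem ndRegular :
    ∀ (C : ℝ) (v : ℝ → EuclideanSpace ℝ (Fin 3) → EuclideanSpace ℝ (Fin 3)),
      Literature.Analysis.FluidPDE.HasTypeITimeDecay C v →
      ContinuousOn (Function.uncurry v) (Set.Iio (0 : ℝ) ×ˢ Set.univ) →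
      (∀ s t : ℝ, s < t → t < 0 → ∀ x, v t x =
        Literature.Analysis.UnboundedOperators.heatExtension (v s) (t - s) x -
          Literature.Analysis.FluidPDE.oseenDuhamel 1 s v v t x) →
      (∀ t < 0, Literature.Analysis.FluidPDE.VectorCalculus.IsDivFree (v t)) →
      (∀ s < 0, ∀ y, ⟪Literature.Analysis.FluidPDE.curl (v s) y, EuclideanSpace.single 2 1⟫_ℝ = 0) →
      ∀ W : Set (ℝ × EuclideanSpace ℝ (Fin 3)), IsOpen W → W.Nonempty → W ⊆ Set.Iio (0 : ℝ) ×ˢ Set.univ →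
        (∀ z ∈ W, Literature.Analysis.FluidPDE.curl (v z.1) z.2 ≠ 0 ∧
          (fderiv ℝ (v z.1) z.2 (EuclideanSpace.single 0 1) 2 ≠ 0 ∨ fderiv ℝ (v z.1) z.2 (EuclideanSpace.single 1 1) 2 ≠ 0) ∧
          (fderiv ℝ (v z.1) z.2 (EuclideanSpace.single 2 1) 0 ≠ 0 ∨ fderiv ℝ (v z.1) z.2 (EuclideanSpace.single 2 1) 1 ≠ 0)) →
        (∀ m : ℝ → ℝ, ∀ W₁ : Set (ℝ × EuclideanSpace ℝ (Fin 3)), W₁ ⊆ W → IsOpen W₁ → W₁.Nonempty →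
          ∃ z ∈ W₁, ∃ b : Fin 3, b ≠ 2 ∧
            fderiv ℝ (v z.1) z.2 (EuclideanSpace.single 2 1) b ≠
              m z.1 * fderiv ℝ (v z.1) z.2 (EuclideanSpace.single b 1) 2) →
        ¬ Literature.Analysis.FluidPDE.IsBackwardSingularPoint v 0 := by
  intro C v hrate hcont hmild hdiv hpol W hW hWne hWs hnd hpin
  set T : ℝ × EuclideanSpace ℝ (Fin 3) → ℝ := fun z =>
    fderiv ℝ (fun x => fderiv ℝ (v z.1) x (EuclideanSpace.single 2 1) 2) z.2 (EuclideanSpace.single 0 1) *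
              fderiv ℝ (v z.1) z.2 (EuclideanSpace.single 1 1) 2 -
            fderiv ℝ (fun x => fderiv ℝ (v z.1) x (EuclideanSpace.single 2 1) 2) z.2 (EuclideanSpace.single 1 1) *
              fderiv ℝ (v z.1) z.2 (EuclideanSpace.single 0 1) 2 with hT
  by_cases htw : ∃ z ∈ W, T z ≠ 0
  · obtain ⟨z₀, hz₀W, hz₀⟩ := htw
    have hslab : IsOpen (Set.Iio (0 : ℝ) ×ˢ (Set.univ : Set (EuclideanSpace ℝ (Fin 3)))) :=
      isOpen_Iio.prod isOpen_univ
    have hTc : ContinuousOn T (Set.Iio (0 : ℝ) ×ˢ Set.univ) := by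
      rw [hT]
      exact continuousOn_twist hrate hcont hmild
    have hO : IsOpen ((Set.Iio (0 : ℝ) ×ˢ Set.univ) ∩ T ⁻¹' {0}ᶜ) :=
      hTc.isOpen_inter_preimage hslab isOpen_compl_singleton
    set W₃ : Set (ℝ × EuclideanSpace ℝ (Fin 3)) := W ∩ ((Set.Iio (0 : ℝ) ×ˢ Set.univ) ∩ T ⁻¹' {0}ᶜ) with hW₃
    have hW₃o : IsOpen W₃ := hW.inter hO
    have hW₃W : W₃ ⊆ W := Set.inter_subset_left
    have hW₃ne : W₃.Nonempty := ⟨z₀, hz₀W, hWs hz₀W, hz₀⟩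
    refine twisting_of_localRigidity C v hrate hcont hmild hdiv hpol W₃ hW₃o hW₃ne (hW₃W.trans hWs)
      (fun z hz => hnd z (hW₃W hz)) (fun m W₁ hW₁ hW₁o hW₁ne => hpin m W₁ (hW₁.trans hW₃W) hW₁o hW₁ne) ?_
    intro z hz
    exact hz.2.2
  · push Not at htw
    exact Summit.NavierStokesRegularity.NavierStokesRegularity.Theorems.PoloidalWindowDoorPoloidalWindowRigidityStubUntwisted.stub_untwisted
      C v hrate hcont hmild hdiv hpol W hW hWne hWs hnd htw

/-- **LRC″ with spatial pins, UNDER THE SINGULARITY ASSUMPTION** (vacuously, from `ndRegular`) — the hypothesis `hLRC` of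
`…K2OfLrcSpatial.nonflatLiouville_of_lrc_spatial`. -/
theorem lrcSpatial_of_stubs :
    ∀ (C : ℝ) (v : ℝ → EuclideanSpace ℝ (Fin 3) → EuclideanSpace ℝ (Fin 3)),
      Literature.Analysis.FluidPDE.HasTypeITimeDecay C v →
      ContinuousOn (Function.uncurry v) (Set.Iio (0 : ℝ) ×ˢ Set.univ) →
      (∀ s t : ℝ, s < t → t < 0 → ∀ x, v t x =
        Literature.Analysis.UnboundedOperators.heatExtension (v s) (t - s) x -
          Literature.Analysis.FluidPDE.oseenDuhamel 1 s v v t x) →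
      (∀ t < 0, Literature.Analysis.FluidPDE.VectorCalculus.IsDivFree (v t)) →
      (∀ s < 0, ∀ y, ⟪Literature.Analysis.FluidPDE.curl (v s) y, EuclideanSpace.single 2 1⟫_ℝ = 0) →
      Literature.Analysis.FluidPDE.IsBackwardSingularPoint v 0 →
      ∀ W : Set (ℝ × EuclideanSpace ℝ (Fin 3)), IsOpen W → W.Nonempty → W ⊆ Set.Iio (0 : ℝ) ×ˢ Set.univ →
        (∀ z ∈ W, Literature.Analysis.FluidPDE.curl (v z.1) z.2 ≠ 0 ∧
          (fderiv ℝ (v z.1) z.2 (EuclideanSpace.single 0 1) 2 ≠ 0 ∨ fderiv ℝ (v z.1) z.2 (EuclideanSpace.single 1 1) 2 ≠ 0) ∧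
          (fderiv ℝ (v z.1) z.2 (EuclideanSpace.single 2 1) 0 ≠ 0 ∨ fderiv ℝ (v z.1) z.2 (EuclideanSpace.single 2 1) 1 ≠ 0)) →
        (∀ m : ℝ → ℝ, ∀ W₁ : Set (ℝ × EuclideanSpace ℝ (Fin 3)), W₁ ⊆ W → IsOpen W₁ → W₁.Nonempty →
          ∃ z ∈ W₁, ∃ b : Fin 3, b ≠ 2 ∧
            fderiv ℝ (v z.1) z.2 (EuclideanSpace.single 2 1) b ≠
              m z.1 * fderiv ℝ (v z.1) z.2 (EuclideanSpace.single b 1) 2) →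
        ∃ s : ℝ, s < 0 ∧ ∃ U : Set (EuclideanSpace ℝ (Fin 3)), IsOpen U ∧ U.Nonempty ∧
          ((∃ e : EuclideanSpace ℝ (Fin 3), e ≠ 0 ∧ ∀ y ∈ U, fderiv ℝ (Literature.Analysis.FluidPDE.curl (v s)) y e = 0) ∨
           (∃ c : EuclideanSpace ℝ (Fin 3), ∀ y ∈ U,
              Literature.Analysis.FluidPDE.rotGen (Literature.Analysis.FluidPDE.curl (v s) y) =
                fderiv ℝ (Literature.Analysis.FluidPDE.curl (v s)) y (Literature.Analysis.FluidPDE.rotGen (y - c)))) := by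
  intro C v hrate hcont hmild hdiv hpol hsing W hW hWne hWs hnd hpin
  exact absurd hsing (ndRegular C v hrate hcont hmild hdiv hpol W hW hWne hWs hnd hpin)

/-- **(TV) — both halves are tree theorems** (`…TimeShearLiminf.stub_tvLiminf`, p525351, and
`…HorizontalFlatPast.nonflatLiouville_of_timeShear_unbounded`): the hypothesis `hTV` of
`…K2OfLrcSpatial.nonflatLiouville_of_lrc_spatial`. -/
theorem tv_of_stubs :
    ∀ (C : ℝ) (v : ℝ → EuclideanSpace ℝ (Fin 3) → EuclideanSpace ℝ (Fin 3)),
      Literature.Analysis.FluidPDE.HasTypeITimeDecay C v →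
      ContinuousOn (Function.uncurry v) (Set.Iio (0 : ℝ) ×ˢ Set.univ) →
      (∀ s t : ℝ, s < t → t < 0 → ∀ x, v t x =
        Literature.Analysis.UnboundedOperators.heatExtension (v s) (t - s) x -
          Literature.Analysis.FluidPDE.oseenDuhamel 1 s v v t x) →
      (∀ t < 0, Literature.Analysis.FluidPDE.VectorCalculus.IsDivFree (v t)) →
      (∀ s < 0, ∀ y, ⟪Literature.Analysis.FluidPDE.curl (v s) y, EuclideanSpace.single 2 1⟫_ℝ = 0) →
      ∀ μ : ℝ → ℝ, (∀ s < 0, μ s < 0) → (∀ s < 0, AnalyticAt ℝ μ s) →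
        (∃ s₁ s₂ : ℝ, s₁ < 0 ∧ s₂ < 0 ∧ μ s₁ ≠ μ s₂) →
        (∀ s < 0, ∀ y, ∀ b : Fin 3, b ≠ 2 →
          fderiv ℝ (v s) y (EuclideanSpace.single 2 1) b = μ s * fderiv ℝ (v s) y (EuclideanSpace.single b 1) 2) →
        ¬ Literature.Analysis.FluidPDE.IsBackwardSingularPoint v 0 := by
  intro C v hrate hcont hmild hdiv hpol μ hneg han hnc hslope
  by_cases hB : ∃ M : ℝ, ∀ T : ℝ, ∃ τ < T, -M ≤ μ τ
  · exact Summit.NavierStokesRegularity.NavierStokesRegularity.Theorems.PoloidalWindowDoorPoloidalWindowRigidityTimeShearLiminf.stub_tvLiminf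
      C v hrate hcont hmild hdiv hpol μ hneg han hnc hslope hB
  · push Not at hB
    refine nonflatLiouville_of_timeShear_unbounded hrate hcont hmild hdiv hpol hslope fun M => ?_
    obtain ⟨T, hT⟩ := hB M
    refine ⟨T, fun τ hτ => ?_⟩
    have h1 : μ τ < -M := hT τ hτ
    have h2 : M < -μ τ := by linarith
    exact h2.le.trans (neg_le_abs (μ τ))

/-- **The slice-sharp residue from the stubs** (symmetry/genericity hypotheses unused): class + poloidal ⇒ not backward-singular,
by contradiction through `…K2OfLrcSpatial.nonflatLiouville_of_lrc_spatial`. -/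
theorem sliceSharpNonflatLiouville_of_localRigidity :
    ∀ (C : ℝ) (v : ℝ → EuclideanSpace ℝ (Fin 3) → EuclideanSpace ℝ (Fin 3)),
      Literature.Analysis.FluidPDE.HasTypeITimeDecay C v →
      ContinuousOn (Function.uncurry v) (Set.Iio (0 : ℝ) ×ˢ Set.univ) →
      (∀ s t : ℝ, s < t → t < 0 → ∀ x, v t x =
        Literature.Analysis.UnboundedOperators.heatExtension (v s) (t - s) x -
          Literature.Analysis.FluidPDE.oseenDuhamel 1 s v v t x) →
      (∀ t < 0, Literature.Analysis.FluidPDE.VectorCalculus.IsDivFree (v t)) →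
      (∀ s < 0, ∀ y, ⟪Literature.Analysis.FluidPDE.curl (v s) y, EuclideanSpace.single 2 1⟫_ℝ = 0) →
      (∀ s < 0, ∀ y, ⟪fderiv ℝ (v s) y (Literature.Analysis.FluidPDE.curl (v s) y), EuclideanSpace.single 2 1⟫_ℝ = 0) →
      (∀ s < 0, ∀ b : EuclideanSpace ℝ (Fin 3), b ≠ 0 → ∃ y,
        Literature.Analysis.FluidPDE.cross (Literature.Analysis.FluidPDE.curl (v s) y) b ≠ 0) →
      (∀ s < 0, ∃ y, fderiv ℝ (v s) y (EuclideanSpace.single 2 1) 0 ≠ 0 ∨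
        fderiv ℝ (v s) y (EuclideanSpace.single 2 1) 1 ≠ 0) →
      (∀ s < 0, ∀ a : EuclideanSpace ℝ (Fin 3), a ≠ 0 → ⟪a, EuclideanSpace.single 2 1⟫_ℝ = 0 →
        ∃ y, ⟪fderiv ℝ (v s) y a, EuclideanSpace.single 2 1⟫_ℝ ≠ 0) →
      (∀ s < 0, ∀ e : EuclideanSpace ℝ (Fin 3), e ≠ 0 → ∃ (y : EuclideanSpace ℝ (Fin 3)) (l : ℝ), v s (y + l • e) ≠ v s y) →
      (∀ s < 0, ∀ (L : EuclideanSpace ℝ (Fin 3) ≃ₗᵢ[ℝ] EuclideanSpace ℝ (Fin 3)) (c : EuclideanSpace ℝ (Fin 3)),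
        ¬ Literature.Analysis.FluidPDE.IsAxisymmetric (fun y => L.symm (v s (L y + c)))) →
      (∃ lam : ℝ, 0 < lam ∧ ∃ s < 0, ∃ y, lam • v (lam ^ 2 * s) (lam • y) ≠ v s y) →
      ¬ Literature.Analysis.FluidPDE.IsBackwardSingularPoint v 0 := by
  intro C v hrate hcont hmild hdiv hpol _ _ _ _ _ _ _ hsing
  exact nonflatLiouville_of_lrc_spatial hrate hcont hmild hdiv hpol
    (lrcSpatial_of_stubs C v hrate hcont hmild hdiv hpol hsing) (tv_of_stubs C v hrate hcont hmild hdiv hpol) hsing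

/-- **COMPOSITION (proved): the crux `PoloidalWindowRigidity` from the two LOCAL stubs `stub_localTHEmpty`, `stub_localThickTH`**,
via the landed reduction `…Sharper.poloidalWindowRigidity_of_sliceSharpNonflatLiouville`. -/
theorem PoloidalWindowRigidity_of_localRigidity :
    Summit.NavierStokesRegularity.NavierStokesRegularity.Theses.PoloidalWindowDoor.PoloidalWindowRigidity :=
  poloidalWindowRigidity_of_sliceSharpNonflatLiouville sliceSharpNonflatLiouville_of_localRigidity

end Summit.NavierStokesRegularity.NavierStokesRegularity.Cruxes.PoloidalWindowRigidity.LocalRigidity
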